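import Mathlib.LinearAlgebra.Eigenspace.Triangularizable
import Literature.Algebra.Lie.LefschetzSl2Type
import HarnessLib

/-!
# An irreducible Lefschetz module of constant `𝔰𝔩₂`-type is `V(n)` or of depth `1` (Looijenga–Lunts 1997, (1.15), second statement)

Topic `Literature/Algebra/Lie` (namespace `Literature.Algebra.Lie`).  Lane `lit-hodgefound` (Track 2 foundations
library), skeleton seat `lit-hodgefound-skel-1` (generation 43), row **A1-118** of
`run/shared/lean/pub/lit-hodgefound/SKELETON.md`: the SECOND sentence of Looijenga–Lunts' (1.15) Proposition
("Moreover, `r > 0` unless (i) … or (ii) …"), with its printed proof, for Lefschetz MODULES `(𝔞, M)` (A1-88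
`IsLefschetzModule`; the representations of a Lefschetz pair are Lefschetz modules by A1-106), continuing A1-113
(`LefschetzSl2Type.lean`, the first sentence).  PROVED theorems only: no definition, no named fact, no `sorry`
(D-0026 net debt `0`).  `LieRing.ofAssociativeRing` is enabled FILE-LOCALLY as in the rest of the series.

## Source, VERBATIM

E. Looijenga, V. A. Lunts, *A Lie algebra attached to a projective variety*, Invent. Math. **129** (1997) 361–412,
§1 (1.15) (held text `paper:arxiv-alg-geom-9604014`, p0014 L3 – p0015 L9 of the materialised text; = p. 7 L106 –
p. 8 L58 of the TeX pagination used by A1-113):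

> "(1.15) Proposition. Let `(𝔤, h)` be a Lefschetz pair and let `M` be an irreducible representation of `𝔤` of depth
> `n`. Then the dimensions of the irreducible `𝔰𝔩(2)`-representations that occur in the `𝔰𝔩(2)`-type of `M` make up
> an arithmetic progression with increment `2`. In other words, there exists an integer `r` with `0 ≤ r ≤ ⌊n/2⌋` such
> that `dim M_{-n} < dim M_{-n+2} < ⋯ < dim M_{-n+2r} = dim M_{-n+2r+2} = ⋯ = dim M_{n-2r} < dim M_{n-2r+2} < ⋯ <
> dim M_n`. Moreover, `r > 0` unless (i) the image of `𝔤` in `𝔤𝔩(M)` is reduced to `𝔰𝔩(2)` with `M ≅ V(n)` or (ii)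
> the `𝔰𝔩(2)`-type of `M` consists of a number of copies of `V(1)`.
> Proof. […] The second statement is proved in a similar way: suppose `M ≅ V(n) ⊗ P` for some nonzero vector space
> `P` with `n ≥ 2`. If `e'` is any element of `𝔞`, then the fact that `e'` and `e` commute, implies that `e'` acts as
> `e ⊗ σ` for some `σ ∈ 𝔤𝔩(P)`. In this way, `𝔞` maps onto subspace `ā` of `𝔤𝔩(P)` that contains the identity of
> `P`. The elements of `e ⊗ ā` commute in `V(n) ⊗ P` and hence the elements of `ā` commute in `P` (here we use that
> `n ≥ 2`).  If `dim P = 1`, then we see that the image of `𝔞` in `𝔤𝔩(M)` consists of multiples of `e`. This implies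
> that the image of `𝔤` in `𝔤𝔩(M)` is a copy of `𝔰𝔩(2)` and that `M ≅ V(n)`. We now show that `dim P ≥ 2` is
> impossible. For this we may assume that `K` is algebraically closed. Then the commutative Lie algebra `ā` leaves
> invariant a line `L ⊂ P`. So every `e' ∈ 𝔞` leaves invariant `V(n) ⊗ L`. If `e'` has the Lefschetz property in
> `M`, then it also has that property in `V(n) ⊗ L`, and so the associated operator `f'` leaves `V(n) ⊗ L` invariant.
> It follows that `𝔤` leaves `V(n) ⊗ L` invariant. This again contradicts the irreducibility of `M`."

## Rendering (dictionary)

* "`(𝔤, h)` a Lefschetz pair, `M` an irreducible representation of depth `n`": as in A1-113 — a Lefschetz module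
  `(𝔞, M)` (`IsLefschetzModule K h 𝔞`, `𝔞 ≤ 𝔤𝔩(M)`) irreducible over `𝔤(𝔞, M)` (`LieModule.IsIrreducible`), an
  `𝔰𝔩₂`-triple `(a, h, f)` of `𝔤𝔩(M)` with `a ∈ 𝔞` (Mathlib `IsSl2Triple h a f`), `n = depth h`.
* "`r = 0`", i.e. "`dim M_{-n} = dim M_{-n+2} = ⋯`": in the notation of A1-113
  (`IsLefschetzModule.exists_primitiveSpace_ne_bot_iff`, `finrank_degreeSpace_neg_add_two_lt_iff`) this says that no
  type `V(n - 2s)`, `1 ≤ s ≤ ⌊n/2⌋`, occurs: `∀ s, 1 ≤ s → 2s ≤ n → primitiveSpace h a (n - 2s) = ⊥`.  For an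
  irreducible `M` all degrees have the parity of `n` (`IsLefschetzModule.degreeSpace_eq_bot_of_ne`, from
  `M = M_ev ⊕ M_odd` of A1-88 §10), so this is the same as "the `𝔰𝔩(2)`-type of `M` consists of copies of `V(n)`
  only": `∀ j ≠ n, primitiveSpace h a j = ⊥` (`IsLefschetzModule.primitiveSpace_eq_bot_of_ne_depth`) — the form in
  which the hypothesis is carried below ("suppose `M ≅ V(n) ⊗ P`").
* "`M ≅ V(n) ⊗ P`", `P = M_{-n}`: under that hypothesis `M_{-n+2i} = a^i (M_{-n})` for `0 ≤ i ≤ n`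
  (`degreeSpace_eq_map_pow_of_le`) and `M = Σ_i a^i (M_{-n})` (`iSup_map_pow_degreeSpace_neg_depth`); "`V(n) ⊗ L`"
  for a subspace `L ⊆ M_{-n}` is the string space `Σ_i a^i (L) = ⨆ i, L.map (a ^ i)`.
* "`e'` acts as `e ⊗ σ`": `e' p ∈ M_{-n+2} = a (M_{-n})` for `p ∈ M_{-n}`, i.e. `e' p = a (σ p)`; "`ā` leaves
  invariant a line `L`" becomes the condition `∀ e' ∈ 𝔞, e' (L) ⊆ a (L)` under which `V(n) ⊗ L` is `𝔞`-stable.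
* "(i) the image of `𝔞` … consists of multiples of `e`", "the image of `𝔤` in `𝔤𝔩(M)` is a copy of `𝔰𝔩(2)`",
  "`M ≅ V(n)`": `𝔞 = K ∙ a`; `𝔤(𝔞, M) = 𝔤(K a, M)` has underlying subspace `span {a, h, f}` (the `𝔰𝔩₂`-triple);
  `dim M = n + 1` with `M` spanned by one string `p₀, a p₀, …, a^n p₀` (which is the standard `(n+1)`-dimensional
  representation of that triple).
* "(ii) the `𝔰𝔩(2)`-type of `M` consists of a number of copies of `V(1)`": given that only `V(n)` occurs, `n = 1`.
* "we may assume that `K` is algebraically closed": the hypothesis `[IsAlgClosed K]` — see SCOPE (a).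

## Contents (all proved)

* §1 `depth_pos` (`n ≥ 1` for `M ≠ 0`, `h ≠ 0`); under "only `V(n)` occurs" (`hiso`):
  `degreeSpace_neg_eq_map_of_primitiveSpace_eq_bot` (`M_{-j} = a M_{-j-2}` if `P_{-j} = 0`),
  **`degreeSpace_eq_map_pow_of_le`** (`M_{-n+2i} = a^i M_{-n}`, `0 ≤ i ≤ n`), `degreeSpace_eq_bot_of_iso` (all other
  `M_m` vanish), **`iSup_map_pow_degreeSpace_neg_depth`** (`M = Σ_{i ≤ n} a^i M_{-n}`),
  `eq_zero_of_pow_apply_eq_zero_of_iso` (`a^{n-i}` is injective on `M_{-n+2i}`).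
* §2 the string space `V(n) ⊗ L = ⨆ i, L.map (a ^ i)` of a subspace `L ⊆ M_{-n}`: its bottom is `L`
  (`eq_degreeSpace_of_iSup_map_pow_eq_top`), it is stable under `a`, under `f` (André's formula, A1-88), under every
  `e'` commuting with `a` with `e' (L) ⊆ a (L)` ("every `e' ∈ 𝔞` leaves invariant `V(n) ⊗ L`") and then under the
  partner `f_{e'}` of a Lefschetz such `e'` ("so the associated operator `f'` leaves `V(n) ⊗ L` invariant" — by
  A1-113's `dual_apply_mem_of_stable`), hence under `𝔤(𝔞, M)` (**`IsLefschetzModule.iSup_map_pow_stable`**, "It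
  follows that `𝔤` leaves `V(n) ⊗ L` invariant"); so for `M` irreducible such an `L` is `0` or `M_{-n}`
  (**`IsLefschetzModule.eq_bot_or_eq_degreeSpace_of_stable`**, "This again contradicts the irreducibility of `M`").
* §3 `K` algebraically closed, `n ≥ 2`: every `e' ∈ 𝔞` is a multiple of `a` on `M_{-n}`
  (**`IsLefschetzModule.exists_forall_apply_eq_smul`**: the eigenspace `{p ∈ M_{-n} | e' p = μ a p}` of "`σ`" is
  `ā`-stable because "the elements of `ā` commute in `P` (here we use that `n ≥ 2`)"), hence every line of `M_{-n}`
  is `ā`-stable and **`dim M_{-n} = 1`** (`IsLefschetzModule.finrank_degreeSpace_neg_depth_eq_one`, "`dim P ≥ 2` is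
  impossible").
* §4 "If `dim P = 1`" (any `K` of characteristic `0`): `exists_eq_smul_of_finrank_eq_one` (a degree-two `e'`
  commuting with `a` is `μ a`), **`IsLefschetzModule.eq_span_singleton_of_finrank_eq_one`** (`𝔞 = K a`, "the image of
  `𝔞` in `𝔤𝔩(M)` consists of multiples of `e`"), **`finrank_eq_depth_add_one_of_finrank_eq_one`** (`dim M = n + 1`,
  "`M ≅ V(n)`"), **`toSubmodule_lefschetzLieAlgebra_span_singleton`** (`𝔤(K a, M) = span {a, h, f}`, "the image of
  `𝔤` in `𝔤𝔩(M)` is a copy of `𝔰𝔩(2)`") and `finrank_span_sl2Triple` (that span has dimension `3`).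
* §5 the parity lemmas `IsLefschetzModule.degreeSpace_eq_bot_of_ne`, `IsLefschetzModule.primitiveSpace_eq_bot_of_ne_depth`
  and **(1.15), second sentence: `IsLefschetzModule.depth_eq_one_or_eq_sl2_of_types_const`** — for `K`
  algebraically closed, `M ≠ 0` irreducible and `r = 0`: either `n = 1` ((ii)) or `𝔞 = K a`, `dim M = n + 1` and
  `𝔤(𝔞, M) = span {a, h, f}` ((i)).

## SCOPE (what is NOT formalised here, and one caveat on the printed text)

(a) The second sentence is formalised for `K` ALGEBRAICALLY CLOSED (of characteristic `0`), which is where the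
printed proof takes place ("For this we may assume that `K` is algebraically closed").  That reduction does not
preserve the irreducibility of `M`, and over a general field of characteristic `0` the sentence fails as printed:
for `K = ℚ`, `L = ℚ(i)` and `n ≥ 2`, the `ℚ`-vector space `M = V(n) ⊗_ℚ L` with `𝔞 = {e ⊗ λ | λ ∈ L}` is an
irreducible Lefschetz `𝔞`-module over `ℚ` (`𝔤(𝔞, M) = 𝔰𝔩₂(L)` viewed over `ℚ`, simple), every occurring type is
`V(n)` (`r = 0`), yet `dim_ℚ M_{-n} = 2`, `M ≇ V(n)` and the image of `𝔤` is not `𝔰𝔩(2)`.  (This example is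
recorded for the Layer-A referee; it is not formalised.)  The steps of the printed proof that do not need
algebraic closure (§1, §2, §4) are stated over any field of characteristic `0`.
(b) As in A1-113 the statement is given for Lefschetz modules; the passage from an irreducible representation of a
Lefschetz pair is A1-106.  (c) "`M ≅ V(n)`" is rendered as `dim M = n + 1` together with the string description
`M = Σ_{i ≤ n} a^i (K p₀)`; no isomorphism with a model of `V(n)` is constructed.  (d) Nothing here concerns complex
tori or the Hodge conjecture.

## References

* [LooijengaLunts1997] E. Looijenga, V. A. Lunts, *A Lie algebra attached to a projective variety*, Invent. Math. 129
  (1997) 361–412; arXiv:alg-geom/9604014. §1 (1.15) and its proof, pp. 14–15 of the held text (p. 7 L106 – p. 8 L58).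
* [Andre1996Motifs] Y. André, *Pour une théorie inconditionnelle des motifs*, Publ. Math. IHÉS 83 (1996) 5–49,
  §1.1 (the operator `ᶜΛ`; used through A1-88 / A1-113).
-/

namespace Literature.Algebra.Lie

open Module Function Set LieModule LieAlgebra
open HasLefschetzProperty (primitiveSpace mem_primitiveSpace_iff)

-- The commutator Lie ring of `𝔤𝔩(M) = Module.End K M`: Mathlib's reducible NON-instance, enabled file-locally
-- exactly as in `LefschetzModule.lean` / `LefschetzSl2Type.lean`.
attribute [local instance 100] LieRing.ofAssociativeRing

/-! ### §1 "Suppose `M ≅ V(n) ⊗ P`": the structure of `M` when only the type `V(n)` occurs -/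

section Isotypic

variable {K : Type*} [Field K] [CharZero K] {M : Type*} [AddCommGroup M] [Module K M] [FiniteDimensional K M]
  {h a : Module.End K M}

/-- **`n ≥ 1`**: a non-zero finite-dimensional `ℤ`-graded `(M, h)` with a Lefschetz operator and `h ≠ 0` has positive
depth (if the depth were `0` then `M = M_0` and `h = 0`). [cite: LooijengaLunts1997, §1 (1.1) p. 4 L58–L60 ("the depth of M")] -/
theorem depth_pos [Nontrivial M] (hgr : IsZGrading h) (La : HasLefschetzProperty h a) (h0 : h ≠ 0) :
    1 ≤ depth h := by
  by_contra hlt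
  have hd : depth h = 0 := by omega
  apply h0
  -- every `M_k`, `k ≠ 0`, vanishes, so `M = M_0` and `h = 0`
  have hk : ∀ k : ℤ, k ≠ 0 → degreeSpace h k = ⊥ := by
    intro k hk
    rcases lt_or_gt_of_ne hk with hk' | hk'
    · obtain ⟨m, rfl⟩ : ∃ m : ℕ, k = -(m : ℤ) := ⟨(-k).toNat, by omega⟩
      exact La.degreeSpace_neg_eq_bot_of_depth_lt (by omega)
    · obtain ⟨m, rfl⟩ : ∃ m : ℕ, k = (m : ℤ) := ⟨k.toNat, by omega⟩
      exact La.degreeSpace_eq_bot_of_depth_lt (by omega)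
  have hgr' : ⨆ k : ℤ, degreeSpace h k = ⊤ := hgr
  have htop : degreeSpace h 0 = ⊤ := by
    rw [eq_top_iff, ← hgr']
    refine iSup_le fun k ↦ ?_
    by_cases hk0 : k = 0
    · rw [hk0]
    · rw [hk k hk0]
      exact bot_le
  ext x
  have hx : x ∈ degreeSpace h 0 := htop ▸ Submodule.mem_top
  rw [mem_degreeSpace_iff, Int.cast_zero, zero_smul] at hx
  rw [hx, LinearMap.zero_apply]

omit [CharZero K] [FiniteDimensional K M] in
/-- **`M_{-j} = a · M_{-j-2}` when `V(j)` does not occur** (`P_{-j} = 0` in the two-term primitive decomposition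
`M_{-j} = P_{-j} ⊕ a M_{-j-2}` of A1-88). [cite: LooijengaLunts1997, §1 (1.15) proof, p. 8 L36 ("suppose M ≅ V(n) ⊗ P")]
[cite: CattaniElZeinGriffithsLe2014, App. A Prop. A.3.9 (A.3.6)] -/
theorem degreeSpace_neg_eq_map_of_primitiveSpace_eq_bot (La : HasLefschetzProperty h a) {j : ℕ}
    (hj : primitiveSpace h a j = ⊥) :
    degreeSpace h (-(j : ℤ)) = (degreeSpace h (-((j : ℤ) + 2))).map a := by
  refine le_antisymm (fun x hx ↦ ?_) ?_
  · obtain ⟨x₀, hx₀, y, hy, hxy⟩ := La.exists_primitive_add hx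
    rw [hj, Submodule.mem_bot] at hx₀
    rw [hxy, hx₀, zero_add]
    exact Submodule.mem_map_of_mem hy
  · rw [Submodule.map_le_iff_le_comap]
    intro y hy
    have h1 := La.apply_mem hy
    rw [Submodule.mem_comap]
    convert h1 using 2
    ring

omit [CharZero K] [FiniteDimensional K M] in
/-- Under "only `V(n)` occurs", **`M_{-n+2i} = a^i M_{-n}` in the non-positive range `2i ≤ n`** (induction on `i`
with the previous lemma). [cite: LooijengaLunts1997, §1 (1.15) proof, p. 8 L36 ("suppose M ≅ V(n) ⊗ P")] -/
theorem degreeSpace_eq_map_pow_of_two_mul_le (La : HasLefschetzProperty h a)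
    (hiso : ∀ j : ℕ, j ≠ depth h → primitiveSpace h a j = ⊥) {i : ℕ} (hi : 2 * i ≤ depth h) :
    degreeSpace h (-(depth h : ℤ) + 2 * i) = (degreeSpace h (-(depth h : ℤ))).map (a ^ i) := by
  induction i with
  | zero =>
    rw [pow_zero, Module.End.one_eq_id, Submodule.map_id]
    congr 1
    push_cast
    ring
  | succ i ih =>
    have ih' := ih (by omega)
    obtain ⟨j, hj⟩ : ∃ j : ℕ, (j : ℤ) = depth h - 2 * i - 2 := ⟨depth h - 2 * i - 2, by omega⟩
    have hjn : j ≠ depth h := by omega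
    have h1 := degreeSpace_neg_eq_map_of_primitiveSpace_eq_bot La (hiso j hjn)
    have e1 : (-(j : ℤ)) = -(depth h : ℤ) + 2 * ((i + 1 : ℕ) : ℤ) := by push_cast; omega
    have e2 : (-((j : ℤ) + 2)) = -(depth h : ℤ) + 2 * (i : ℤ) := by omega
    rw [e1, e2, ih', ← Submodule.map_comp] at h1
    rw [h1, pow_succ', Module.End.mul_eq_comp]

omit [CharZero K] [FiniteDimensional K M] in
/-- **`M_{-n+2i} = a^i M_{-n}` for all `0 ≤ i ≤ n`** under "only `V(n)` occurs" — the positive range by the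
Lefschetz bijections `a^m : M_{-m} ≅ M_m` ("suppose `M ≅ V(n) ⊗ P`": `M` is the sum of the `a`-strings of
`P = M_{-n}`). [cite: LooijengaLunts1997, §1 (1.15) proof, p. 8 L36] -/
theorem degreeSpace_eq_map_pow_of_le (La : HasLefschetzProperty h a)
    (hiso : ∀ j : ℕ, j ≠ depth h → primitiveSpace h a j = ⊥) {i : ℕ} (hi : i ≤ depth h) :
    degreeSpace h (-(depth h : ℤ) + 2 * i) = (degreeSpace h (-(depth h : ℤ))).map (a ^ i) := by
  by_cases h2 : 2 * i ≤ depth h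
  · exact degreeSpace_eq_map_pow_of_two_mul_le La hiso h2
  · -- positive degree `m = 2i - n`: `M_m = a^m M_{-m}` and `M_{-m} = a^{n-i} M_{-n}`
    obtain ⟨m, hm⟩ : ∃ m : ℕ, (m : ℤ) = 2 * i - depth h := ⟨2 * i - depth h, by omega⟩
    have hneg : degreeSpace h (-(m : ℤ)) = (degreeSpace h (-(depth h : ℤ))).map (a ^ (depth h - i)) := by
      have h1 := degreeSpace_eq_map_pow_of_two_mul_le La hiso (i := depth h - i) (by omega)
      have e1 : (-(depth h : ℤ) + 2 * ((depth h - i : ℕ) : ℤ)) = -(m : ℤ) := by omega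
      rwa [e1] at h1
    have hpos : degreeSpace h (m : ℤ) = (degreeSpace h (-(m : ℤ))).map (a ^ m) := by
      refine le_antisymm (fun y hy ↦ ?_) ?_
      · obtain ⟨x, hx, rfl⟩ := (La.bijOn m).surjOn hy
        exact Submodule.mem_map_of_mem hx
      · rw [Submodule.map_le_iff_le_comap]
        intro x hx
        exact (La.bijOn m).mapsTo hx
    have e2 : (-(depth h : ℤ) + 2 * i) = (m : ℤ) := by omega
    have e3 : m + (depth h - i) = i := by omega
    rw [e2, hpos, hneg, ← Submodule.map_comp, ← Module.End.mul_eq_comp, ← pow_add, e3]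

/-- Under "only `V(n)` occurs", **every other degree part vanishes**: `M_m = 0` unless `m = -n + 2i` with
`0 ≤ i ≤ n` (degrees beyond `±n` by the depth, degrees of the other parity by `M_{-j} = a M_{-j-2}` downwards).
[cite: LooijengaLunts1997, §1 (1.15) proof, p. 8 L36] -/
theorem degreeSpace_eq_bot_of_iso (La : HasLefschetzProperty h a)
    (hiso : ∀ j : ℕ, j ≠ depth h → primitiveSpace h a j = ⊥) {m : ℤ}
    (hm : ∀ i : ℕ, i ≤ depth h → m ≠ -(depth h : ℤ) + 2 * i) : degreeSpace h m = ⊥ := by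
  -- non-positive degrees `-j`, by downward induction on `j`
  have key : ∀ d j : ℕ, depth h < j + 2 * d →
      (∀ i : ℕ, i ≤ depth h → (-(j : ℤ)) ≠ -(depth h : ℤ) + 2 * i) → degreeSpace h (-(j : ℤ)) = ⊥ := by
    intro d
    induction d with
    | zero =>
      intro j hj _
      exact La.degreeSpace_neg_eq_bot_of_depth_lt (by omega)
    | succ d ih =>
      intro j hj hne
      rcases lt_or_ge (depth h) j with hlt | hle
      · exact La.degreeSpace_neg_eq_bot_of_depth_lt hlt
      · have hjn : j ≠ depth h := fun hje ↦ hne 0 (Nat.zero_le _) (by rw [hje]; simp)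
        rw [degreeSpace_neg_eq_map_of_primitiveSpace_eq_bot La (hiso j hjn)]
        have e1 : (-((j : ℤ) + 2)) = -((j + 2 : ℕ) : ℤ) := by push_cast; ring
        rw [e1, ih (j + 2) (by omega) fun i hi hc ↦ hne (i + 1) (by omega) (by push_cast at hc ⊢; omega),
          Submodule.map_bot]
  rcases le_or_gt m 0 with hm0 | hm0
  · obtain ⟨j, rfl⟩ : ∃ j : ℕ, m = -(j : ℤ) := ⟨(-m).toNat, by omega⟩
    exact key (depth h + 1) j (by omega) hm
  · obtain ⟨j, rfl⟩ : ∃ j : ℕ, m = (j : ℤ) := ⟨m.toNat, by omega⟩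
    have hneg : degreeSpace h (-(j : ℤ)) = ⊥ := by
      refine key (depth h + 1) j (by omega) fun i hi hc ↦ hm (depth h - i) (by omega) ?_
      rw [Nat.cast_sub hi]
      omega
    rw [eq_bot_iff]
    intro y hy
    obtain ⟨x, hx, rfl⟩ := (La.bijOn j).surjOn hy
    rw [SetLike.mem_coe, hneg, Submodule.mem_bot] at hx
    rw [hx, map_zero]
    exact Submodule.zero_mem _

/-- Under "only `V(n)` occurs", **`M = Σ_{i ≤ n} a^i (M_{-n})`** ("suppose `M ≅ V(n) ⊗ P`" with `P = M_{-n}`).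
[cite: LooijengaLunts1997, §1 (1.15) proof, p. 8 L36] -/
theorem iSup_map_pow_degreeSpace_neg_depth (hgr : IsZGrading h) (La : HasLefschetzProperty h a)
    (hiso : ∀ j : ℕ, j ≠ depth h → primitiveSpace h a j = ⊥) :
    ⨆ i : Fin (depth h + 1), (degreeSpace h (-(depth h : ℤ))).map (a ^ (i : ℕ)) = ⊤ := by
  have hgr' : ⨆ k : ℤ, degreeSpace h k = ⊤ := hgr
  rw [eq_top_iff, ← hgr']
  refine iSup_le fun m ↦ ?_
  by_cases hm : ∃ i : ℕ, i ≤ depth h ∧ m = -(depth h : ℤ) + 2 * i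
  · obtain ⟨i, hi, rfl⟩ := hm
    rw [degreeSpace_eq_map_pow_of_le La hiso hi]
    exact le_iSup (fun i : Fin (depth h + 1) ↦ (degreeSpace h (-(depth h : ℤ))).map (a ^ (i : ℕ)))
      ⟨i, by omega⟩
  · push Not at hm
    rw [degreeSpace_eq_bot_of_iso La hiso hm]
    exact bot_le

omit [CharZero K] [FiniteDimensional K M] in
/-- Under "only `V(n)` occurs", **`a^{n-i}` is injective on `M_{-n+2i}`** (`0 ≤ i ≤ n`): `a^n` is injective on
`M_{-n}`. [cite: LooijengaLunts1997, §1 (1.15) proof, p. 8 L40 ("here we use that n ≥ 2")] -/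
theorem eq_zero_of_pow_apply_eq_zero_of_iso (La : HasLefschetzProperty h a)
    (hiso : ∀ j : ℕ, j ≠ depth h → primitiveSpace h a j = ⊥) {i : ℕ} (hi : i ≤ depth h) {y : M}
    (hy : y ∈ degreeSpace h (-(depth h : ℤ) + 2 * i)) (h0 : (a ^ (depth h - i)) y = 0) : y = 0 := by
  rw [degreeSpace_eq_map_pow_of_le La hiso hi, Submodule.mem_map] at hy
  obtain ⟨x, hx, rfl⟩ := hy
  have h1 : (a ^ depth h) x = 0 := by
    have e1 : a ^ depth h = a ^ (depth h - i) * a ^ i := by rw [← pow_add, Nat.sub_add_cancel hi]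
    rw [e1, Module.End.mul_apply, h0]
  have h2 : x = 0 :=
    La.eq_zero_of_pow_apply_eq_zero (n := (depth h : ℤ)) (by omega) hx (by simpa using h1)
  rw [h2, map_zero]

end Isotypic

/-! ### §2 "`V(n) ⊗ L`": the string space of a subspace `L ⊆ M_{-n}` and its stability -/

section Strings

variable {K : Type*} [Field K] [CharZero K] {M : Type*} [AddCommGroup M] [Module K M] [FiniteDimensional K M]
  {h a : Module.End K M} {L : Submodule K M}

omit [CharZero K] [FiniteDimensional K M] in
/-- `a^i l` lies in the string space `Σ_i a^i (L)`. [cite: LooijengaLunts1997, §1 (1.15) proof, p. 8 L43 ("V(n) ⊗ L")] -/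
theorem pow_apply_mem_iSup_map_pow {l : M} (hl : l ∈ L) (i : ℕ) : (a ^ i) l ∈ ⨆ i : ℕ, L.map (a ^ i) :=
  Submodule.mem_iSup_of_mem i (Submodule.mem_map_of_mem hl)

omit [CharZero K] [FiniteDimensional K M] in
/-- `a^i (L) ⊆ M_{-n+2i}` for `L ⊆ M_{-n}`. [cite: LooijengaLunts1997, §1 (1.15) proof, p. 8 L43] -/
theorem map_pow_le_degreeSpace (La : HasLefschetzProperty h a) (hL : L ≤ degreeSpace h (-(depth h : ℤ)))
    (i : ℕ) : L.map (a ^ i) ≤ degreeSpace h (-(depth h : ℤ) + 2 * i) := by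
  rw [Submodule.map_le_iff_le_comap]
  intro x hx
  exact pow_apply_mem_degreeSpace La.mapsTo (hL hx) i

omit [FiniteDimensional K M] in
/-- **The bottom of `V(n) ⊗ L` is `L`**: if the string space of `L ⊆ M_{-n}` is all of `M`, then `L = M_{-n}`
(degrees `-n + 2i`, `i ≥ 1`, are disjoint from `M_{-n}`). [cite: LooijengaLunts1997, §1 (1.15) proof, p. 8 L43–L46] -/
theorem eq_degreeSpace_of_iSup_map_pow_eq_top (La : HasLefschetzProperty h a)
    (hL : L ≤ degreeSpace h (-(depth h : ℤ))) (htop : ⨆ i : ℕ, L.map (a ^ i) = ⊤) :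
    L = degreeSpace h (-(depth h : ℤ)) := by
  refine le_antisymm hL fun p hp ↦ ?_
  have hp' : p ∈ ⨆ i : ℕ, L.map (a ^ i) := by rw [htop]; exact Submodule.mem_top
  rw [iSup_split_single (fun i : ℕ ↦ L.map (a ^ i)) 0, Submodule.mem_sup] at hp'
  obtain ⟨l, hl, r, hr, hlr⟩ := hp'
  rw [pow_zero, Module.End.one_eq_id, Submodule.map_id] at hl
  have hle2 : (⨆ (i : ℕ) (_ : i ≠ 0), L.map (a ^ i)) ≤ ⨆ k : ℤ, ⨆ (_ : -(depth h : ℤ) + 2 ≤ k), degreeSpace h k :=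
    iSup₂_le fun i hi ↦ (map_pow_le_degreeSpace La hL i).trans
      (le_iSup₂_of_le (f := fun k (_ : -(depth h : ℤ) + 2 ≤ k) ↦ degreeSpace h k) (-(depth h : ℤ) + 2 * i)
        (by omega) le_rfl)
  have hr' : r ∈ ⨆ k : ℤ, ⨆ (_ : -(depth h : ℤ) + 2 ≤ k), degreeSpace h k := hle2 hr
  have hrp : r ∈ degreeSpace h (-(depth h : ℤ)) := by
    have e1 : r = p - l := by rw [← hlr]; abel
    rw [e1]
    exact Submodule.sub_mem _ hp (hL hl)
  have hr0 : r = 0 := (Submodule.disjoint_def.1 (disjoint_degreeSpace_biSup (h := h)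
    (show -(depth h : ℤ) < -(depth h : ℤ) + 2 by omega))) r hrp hr'
  rw [← hlr, hr0, add_zero]
  exact hl

omit [CharZero K] [FiniteDimensional K M] in
/-- The string space is stable under `a`. [cite: LooijengaLunts1997, §1 (1.15) proof, p. 8 L43–L46] -/
theorem apply_mem_iSup_map_pow_of_mem {x : M} (hx : x ∈ ⨆ i : ℕ, L.map (a ^ i)) :
    a x ∈ ⨆ i : ℕ, L.map (a ^ i) := by
  refine Submodule.iSup_induction (fun i : ℕ ↦ L.map (a ^ i)) (motive := fun x ↦ a x ∈ ⨆ i : ℕ, L.map (a ^ i))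
    hx ?_ ?_ ?_
  · intro i x hx
    obtain ⟨l, hl, rfl⟩ := Submodule.mem_map.1 hx
    rw [← Module.End.mul_apply, ← pow_succ']
    exact pow_apply_mem_iSup_map_pow hl (i + 1)
  · rw [map_zero]
    exact Submodule.zero_mem _
  · intro x y hx hy
    rw [map_add]
    exact Submodule.add_mem _ hx hy

/-- The string space of `L ⊆ M_{-n}` is stable under the partner `f` of `a`: the elements of `M_{-n}` are primitive
and `f (a^{i+1} l) = (i+1)(n-i) a^i l`, `f l = 0` (André's formula, A1-88). [cite: LooijengaLunts1997, §1 (1.15) proof, p. 8 L43–L46]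
[cite: Andre1996Motifs, §1.1 (formula for ᶜΛ)] -/
theorem f_apply_mem_iSup_map_pow (hgr : IsZGrading h) {f : Module.End K M} (t : IsSl2Triple h a f)
    (hL : L ≤ degreeSpace h (-(depth h : ℤ))) {x : M} (hx : x ∈ ⨆ i : ℕ, L.map (a ^ i)) :
    f x ∈ ⨆ i : ℕ, L.map (a ^ i) := by
  have La := hasLefschetzProperty_of_isSl2Triple hgr t
  have hprim : ∀ l ∈ L, l ∈ primitiveSpace h a (depth h) := fun l hl ↦ by
    rw [mem_primitiveSpace_iff]
    refine ⟨hL hl, ?_⟩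
    have h1 : (a ^ (depth h + 1)) l ∈ degreeSpace h ((depth h + 2 : ℕ) : ℤ) := by
      have h2 := La.pow_apply_mem (hL hl) (depth h + 1)
      convert h2 using 2
      push_cast
      ring
    rw [La.degreeSpace_eq_bot_of_depth_lt (by omega), Submodule.mem_bot] at h1
    exact h1
  rw [La.eq_dual_of_isSl2Triple hgr t]
  refine Submodule.iSup_induction (fun i : ℕ ↦ L.map (a ^ i))
    (motive := fun x ↦ La.dual hgr x ∈ ⨆ i : ℕ, L.map (a ^ i)) hx ?_ ?_ ?_
  · intro i x hx
    obtain ⟨l, hl, rfl⟩ := Submodule.mem_map.1 hx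
    rcases i with _ | i
    · rw [pow_zero, Module.End.one_apply, La.dual_apply_primitive hgr (hprim l hl)]
      exact Submodule.zero_mem _
    · rw [La.dual_apply_pow_primitive hgr (hprim l hl) i]
      exact Submodule.smul_mem _ _ (pow_apply_mem_iSup_map_pow hl i)
  · rw [map_zero]
    exact Submodule.zero_mem _
  · intro x y hx hy
    rw [map_add]
    exact Submodule.add_mem _ hx hy

omit [CharZero K] [FiniteDimensional K M] in
/-- **"every `e' ∈ 𝔞` leaves invariant `V(n) ⊗ L`"**: an operator `e'` commuting with `a` and with
`e' (L) ⊆ a (L)` ("`e'` acts as `e ⊗ σ`" with `σ (L) ⊆ L`) preserves the string space of `L`.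
[cite: LooijengaLunts1997, §1 (1.15) proof, p. 8 L37–L38, L43–L44] -/
theorem apply_mem_iSup_map_pow_of_commute {e' : Module.End K M} (hc : Commute a e')
    (hLe : ∀ l ∈ L, e' l ∈ L.map a) {x : M} (hx : x ∈ ⨆ i : ℕ, L.map (a ^ i)) :
    e' x ∈ ⨆ i : ℕ, L.map (a ^ i) := by
  refine Submodule.iSup_induction (fun i : ℕ ↦ L.map (a ^ i)) (motive := fun x ↦ e' x ∈ ⨆ i : ℕ, L.map (a ^ i))
    hx ?_ ?_ ?_
  · intro i x hx
    obtain ⟨l, hl, rfl⟩ := Submodule.mem_map.1 hx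
    obtain ⟨l', hl', hel⟩ := Submodule.mem_map.1 (hLe l hl)
    have h1 : e' ((a ^ i) l) = (a ^ (i + 1)) l' := by
      rw [← Module.End.mul_apply, ← (hc.pow_left i).eq, Module.End.mul_apply, ← hel, ← Module.End.mul_apply,
        ← pow_succ]
    rw [h1]
    exact pow_apply_mem_iSup_map_pow hl' (i + 1)
  · rw [map_zero]
    exact Submodule.zero_mem _
  · intro x y hx hy
    rw [map_add]
    exact Submodule.add_mem _ hx hy

/-- **"If `e'` has the Lefschetz property in `M`, then … the associated operator `f'` leaves `V(n) ⊗ L`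
invariant"**: for a Lefschetz `e'` commuting with `a` with `e' (L) ⊆ a (L)`, the partner `f_{e'}` preserves the
string space of `L ⊆ M_{-n}` (A1-113 `dual_apply_mem_of_stable`: the string space is stable under `a`, `f`, `e'`, so
`e'^m` maps its degree `-m` part onto its degree `m` part). [cite: LooijengaLunts1997, §1 (1.15) proof, p. 8 L44–L45] -/
theorem dual_apply_mem_iSup_map_pow (hgr : IsZGrading h) {f : Module.End K M} (t : IsSl2Triple h a f)
    {e' : Module.End K M} (Le' : HasLefschetzProperty h e') (hc : Commute a e')
    (hL : L ≤ degreeSpace h (-(depth h : ℤ))) (hLe : ∀ l ∈ L, e' l ∈ L.map a)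
    {x : M} (hx : x ∈ ⨆ i : ℕ, L.map (a ^ i)) : Le'.dual hgr x ∈ ⨆ i : ℕ, L.map (a ^ i) := by
  have La := hasLefschetzProperty_of_isSl2Triple hgr t
  set N : Submodule K M := ⨆ i : ℕ, L.map (a ^ i) with hN
  have hNa : ∀ v ∈ N, a v ∈ N := fun v hv ↦ apply_mem_iSup_map_pow_of_mem hv
  have hNf : ∀ v ∈ N, f v ∈ N := fun v hv ↦ f_apply_mem_iSup_map_pow hgr t hL hv
  have hNe' : ∀ v ∈ N, e' v ∈ N := fun v hv ↦ apply_mem_iSup_map_pow_of_commute hc hLe hv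
  have hsurj : ∀ m : ℕ, ∀ y ∈ N, y ∈ degreeSpace h m →
      ∃ x ∈ N, x ∈ degreeSpace h (-(m : ℤ)) ∧ (e' ^ m) x = y :=
    fun m y hyN hy ↦ exists_pow_apply_eq_of_stable hgr t Le' hNa hNf hNe' m hyN hy
  refine Submodule.iSup_induction (fun i : ℕ ↦ L.map (a ^ i)) (motive := fun x ↦ Le'.dual hgr x ∈ N) hx ?_ ?_ ?_
  · intro i x hx'
    have hxN : x ∈ N := Submodule.mem_iSup_of_mem i hx'
    obtain ⟨l, hl, rfl⟩ := Submodule.mem_map.1 hx'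
    exact dual_apply_mem_of_stable hgr Le' hNe' hsurj hxN (pow_apply_mem_degreeSpace La.mapsTo (hL hl) i)
  · rw [map_zero]
    exact Submodule.zero_mem _
  · intro x y hx hy
    rw [map_add]
    exact Submodule.add_mem _ hx hy

variable {𝔞 : Submodule K (Module.End K M)}

/-- **"It follows that `𝔤` leaves `V(n) ⊗ L` invariant"**: for a Lefschetz module `(𝔞, M)`, an `𝔰𝔩₂`-triple
`(a, h, f)` with `a ∈ 𝔞` and a subspace `L ⊆ M_{-n}` with `e' (L) ⊆ a (L)` for all `e' ∈ 𝔞`, the string space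
`Σ_i a^i (L)` is `𝔤(𝔞, M)`-stable. [cite: LooijengaLunts1997, §1 (1.15) proof, p. 8 L43–L46] -/
theorem IsLefschetzModule.iSup_map_pow_stable (A : IsLefschetzModule K h 𝔞) {f : Module.End K M} (ha : a ∈ 𝔞)
    (t : IsSl2Triple h a f) (hL : L ≤ degreeSpace h (-(depth h : ℤ)))
    (hLe : ∀ e' ∈ 𝔞, ∀ l ∈ L, e' l ∈ L.map a) {x : Module.End K M} (hx : x ∈ lefschetzLieAlgebra K h 𝔞) :
    ∀ v ∈ ⨆ i : ℕ, L.map (a ^ i), x v ∈ ⨆ i : ℕ, L.map (a ^ i) := by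
  have hgr := A.isZGrading
  rw [lefschetzLieAlgebra] at hx
  induction hx using LieSubalgebra.lieSpan_induction with
  | mem x hx =>
    rcases hx with hx | ⟨e', he', t'⟩
    · exact fun v hv ↦ apply_mem_iSup_map_pow_of_commute (A.commute ha hx) (hLe x hx) hv
    · have Le' := hasLefschetzProperty_of_isSl2Triple hgr t'
      rw [Le'.eq_dual_of_isSl2Triple hgr t']
      exact fun v hv ↦ dual_apply_mem_iSup_map_pow hgr t Le' (A.commute ha he') hL (hLe e' he') hv
  | zero => intro v _; rw [LinearMap.zero_apply]; exact Submodule.zero_mem _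
  | add x y _ _ hx hy => intro v hv; rw [LinearMap.add_apply]; exact Submodule.add_mem _ (hx v hv) (hy v hv)
  | smul c x _ hx => intro v hv; rw [LinearMap.smul_apply]; exact Submodule.smul_mem _ c (hx v hv)
  | lie x y _ _ hx hy =>
    intro v hv
    rw [Ring.lie_def, LinearMap.sub_apply, Module.End.mul_apply, Module.End.mul_apply]
    exact Submodule.sub_mem _ (hx _ (hy v hv)) (hy _ (hx v hv))

/-- **"This again contradicts the irreducibility of `M`"**: in an irreducible Lefschetz module, a subspace
`L ⊆ M_{-n}` with `e' (L) ⊆ a (L)` for all `e' ∈ 𝔞` is `0` or all of `M_{-n}` (its string space is a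
`𝔤(𝔞, M)`-submodule with bottom `L`). [cite: LooijengaLunts1997, §1 (1.15) proof, p. 8 L43–L46] -/
theorem IsLefschetzModule.eq_bot_or_eq_degreeSpace_of_stable (A : IsLefschetzModule K h 𝔞) [Nontrivial M]
    [LieModule.IsIrreducible K (lefschetzLieAlgebra K h 𝔞) M] {f : Module.End K M} (ha : a ∈ 𝔞)
    (t : IsSl2Triple h a f) (hL : L ≤ degreeSpace h (-(depth h : ℤ)))
    (hLe : ∀ e' ∈ 𝔞, ∀ l ∈ L, e' l ∈ L.map a) : L = ⊥ ∨ L = degreeSpace h (-(depth h : ℤ)) := by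
  have hgr := A.isZGrading
  have La := hasLefschetzProperty_of_isSl2Triple hgr t
  rcases (isIrreducible_iff_forall_stable (h := h) (𝔞 := 𝔞)).1 ‹_› (⨆ i : ℕ, L.map (a ^ i))
    (fun x hx ↦ A.iSup_map_pow_stable ha t hL hLe hx) with h1 | h1
  · left
    rw [eq_bot_iff, ← h1]
    intro l hl
    simpa using pow_apply_mem_iSup_map_pow (a := a) hl 0
  · right
    exact eq_degreeSpace_of_iSup_map_pow_eq_top La hL h1

end Strings

/-! ### §3 "`dim P ≥ 2` is impossible" over an algebraically closed field -/

section AlgClosed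

variable {K : Type*} [Field K] [CharZero K] {M : Type*} [AddCommGroup M] [Module K M] [FiniteDimensional K M]
  {h a : Module.End K M} {𝔞 : Submodule K (Module.End K M)}

/-- **Every `e' ∈ 𝔞` is a multiple of `a` on `M_{-n}`** when only `V(n)` occurs, `n ≥ 2`, `M` is irreducible and
`K` is algebraically closed.  Printed: "`e'` acts as `e ⊗ σ` … the elements of `ā` commute in `P` (here we use that
`n ≥ 2`) … the commutative Lie algebra `ā` leaves invariant a line `L ⊂ P` … contradicts the irreducibility".
Rendered: with `σ = g_n ∘ a^{n-1} ∘ e'` on `P = M_{-n}` (so that `a ∘ σ = e'`) and an eigenvalue `μ` of `σ`, the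
subspace `{p ∈ M_{-n} | e' p = μ a p} ≠ 0` satisfies the stability hypothesis of
`eq_bot_or_eq_degreeSpace_of_stable` (this is where the `e''`, `e'`, `a` commute and `a` is injective on `M_{-n+2}`,
`n ≥ 2`), hence is all of `M_{-n}`. [cite: LooijengaLunts1997, §1 (1.15) proof, p. 8 L36–L46] -/
theorem IsLefschetzModule.exists_forall_apply_eq_smul [IsAlgClosed K] (A : IsLefschetzModule K h 𝔞) [Nontrivial M]
    [LieModule.IsIrreducible K (lefschetzLieAlgebra K h 𝔞) M] {f : Module.End K M} (ha : a ∈ 𝔞)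
    (t : IsSl2Triple h a f) (hiso : ∀ j : ℕ, j ≠ depth h → primitiveSpace h a j = ⊥) (hn : 2 ≤ depth h)
    {e' : Module.End K M} (he' : e' ∈ 𝔞) :
    ∃ μ : K, ∀ p ∈ degreeSpace h (-(depth h : ℤ)), e' p = μ • a p := by
  have hgr := A.isZGrading
  have La := hasLefschetzProperty_of_isSl2Triple hgr t
  have hc : Commute a e' := A.commute ha he'
  have hn0 : (0 : ℤ) ≤ (depth h : ℤ) := by omega
  -- degree bookkeeping: `e' p - c • a p ∈ M_{-n+2}` for `p ∈ M_{-n}`, and `a^{n-1}` is injective there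
  have hdeg : ∀ p ∈ degreeSpace h (-(depth h : ℤ)), ∀ c : K,
      e' p - c • a p ∈ degreeSpace h (-(depth h : ℤ) + 2 * (1 : ℕ)) := by
    intro p hp c
    have e1 : (-(depth h : ℤ) + 2 * (1 : ℕ)) = -(depth h : ℤ) + 2 := by norm_num
    rw [e1]
    exact Submodule.sub_mem _ (A.mapsTo he' _ hp) (Submodule.smul_mem _ c (La.apply_mem hp))
  have hinj : ∀ y ∈ degreeSpace h (-(depth h : ℤ) + 2 * (1 : ℕ)), (a ^ (depth h - 1)) y = 0 → y = 0 :=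
    fun y hy hy0 ↦ eq_zero_of_pow_apply_eq_zero_of_iso La hiso (i := 1) (by omega) hy hy0
  -- `σ = g_n ∘ a^{n-1} ∘ e'` on `M_{-n}`
  have hρ : ∀ p ∈ degreeSpace h (-(depth h : ℤ)), (a ^ (depth h - 1) * e') p ∈ degreeSpace h (depth h : ℤ) := by
    intro p hp
    rw [Module.End.mul_apply]
    have h1 := pow_apply_mem_degreeSpace La.mapsTo (A.mapsTo he' _ hp) (depth h - 1)
    convert h1 using 2
    rw [Nat.cast_sub (show 1 ≤ depth h by omega)]
    push_cast
    ring
  set ρ : degreeSpace h (-(depth h : ℤ)) →ₗ[K] degreeSpace h (depth h : ℤ) :=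
    (a ^ (depth h - 1) * e').restrict hρ with hρ_def
  set σ : degreeSpace h (-(depth h : ℤ)) →ₗ[K] degreeSpace h (-(depth h : ℤ)) :=
    LinearMap.codRestrict (degreeSpace h (-(depth h : ℤ))) (La.inv (depth h : ℤ) ∘ₗ ρ)
      (fun p ↦ La.inv_mem hn0 (ρ p)) with hσ_def
  have hσ : ∀ p : degreeSpace h (-(depth h : ℤ)), (a ^ depth h) (σ p : M) = (a ^ (depth h - 1)) (e' p) := by
    intro p
    have h1 := La.pow_apply_inv hn0 (ρ p)
    rw [Int.toNat_natCast] at h1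
    simpa only [hσ_def, hρ_def, LinearMap.codRestrict_apply, LinearMap.comp_apply, LinearMap.restrict_apply,
      Module.End.mul_apply] using h1
  -- an eigenvector `v` of `σ`: `e' v = μ a v`
  haveI : Nontrivial (degreeSpace h (-(depth h : ℤ))) :=
    Submodule.nontrivial_iff_ne_bot.2 (La.degreeSpace_neg_depth_ne_bot hgr)
  obtain ⟨μ, hμ⟩ := Module.End.exists_eigenvalue σ
  obtain ⟨v, hv⟩ := hμ.exists_hasEigenvector
  refine ⟨μ, ?_⟩
  have hvE : e' (v : M) = μ • a (v : M) := by
    have h1 : σ v = μ • v := hv.apply_eq_smul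
    have h3 : (a ^ (depth h - 1)) (a (v : M)) = (a ^ depth h) (v : M) := by
      rw [← Module.End.mul_apply, ← pow_succ, Nat.sub_add_cancel (show 1 ≤ depth h by omega)]
    have h2 : (a ^ (depth h - 1)) (e' v - μ • a v) = 0 := by
      rw [map_sub, map_smul, h3, ← hσ v, h1, Submodule.coe_smul, map_smul, sub_self]
    exact sub_eq_zero.1 (hinj _ (hdeg v v.2 μ) h2)
  -- the "eigenspace" `E = {p ∈ M_{-n} | e' p = μ a p}` is stable in the sense of §2
  set E : Submodule K M := degreeSpace h (-(depth h : ℤ)) ⊓ LinearMap.ker (e' - μ • a) with hE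
  have hmemE : ∀ {p : M}, p ∈ E ↔ p ∈ degreeSpace h (-(depth h : ℤ)) ∧ e' p = μ • a p := by
    intro p
    rw [hE, Submodule.mem_inf, LinearMap.mem_ker, LinearMap.sub_apply, LinearMap.smul_apply, sub_eq_zero]
  have hEle : E ≤ degreeSpace h (-(depth h : ℤ)) := fun p hp ↦ (hmemE.1 hp).1
  have hEe : ∀ e'' ∈ 𝔞, ∀ p ∈ E, e'' p ∈ E.map a := by
    intro e'' he'' p hp
    obtain ⟨hp, hep⟩ := hmemE.1 hp
    -- `e'' p ∈ M_{-n+2} = a (M_{-n})`: `e'' p = a q`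
    have h1 : e'' p ∈ degreeSpace h (-(depth h : ℤ) + 2 * (1 : ℕ)) := by
      have h2 := A.mapsTo he'' _ hp
      convert h2 using 2
      norm_num
    rw [degreeSpace_eq_map_pow_of_le La hiso (i := 1) (by omega), pow_one] at h1
    obtain ⟨q, hq, hq'⟩ := Submodule.mem_map.1 h1
    refine Submodule.mem_map.2 ⟨q, hmemE.2 ⟨hq, ?_⟩, hq'⟩
    -- `a (e' q - μ a q) = e'' (e' p - μ a p) = 0`, and `a` is injective on `M_{-n+2}` (`n ≥ 2`)
    have hc'' : Commute a e'' := A.commute ha he''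
    have hc3 : Commute e' e'' := A.commute he' he''
    have h2 : a (e' q - μ • a q) = 0 := by
      have h2a : a (e' q) = e' (a q) := by rw [← Module.End.mul_apply, hc.eq, Module.End.mul_apply]
      have h2b : e' (e'' p) = e'' (e' p) := by rw [← Module.End.mul_apply, hc3.eq, Module.End.mul_apply]
      have h2c : a (e'' p) = e'' (a p) := by rw [← Module.End.mul_apply, hc''.eq, Module.End.mul_apply]
      rw [map_sub, map_smul, h2a, hq', h2b, h2c, hep, map_smul, sub_self]
    have h3 : (a ^ (depth h - 1)) (e' q - μ • a q) = 0 := by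
      have e1 : a ^ (depth h - 1) = a ^ (depth h - 2) * a := by
        rw [← pow_succ]
        congr 1
        omega
      rw [e1, Module.End.mul_apply, h2, map_zero]
    exact sub_eq_zero.1 (hinj _ (hdeg q hq μ) h3)
  have hvE' : (v : M) ∈ E := hmemE.2 ⟨v.2, hvE⟩
  have hv0 : (v : M) ≠ 0 := fun h0 ↦ hv.right (Subtype.ext h0)
  rcases A.eq_bot_or_eq_degreeSpace_of_stable ha t hEle hEe with h1 | h1
  · exact absurd ((Submodule.mem_bot K).1 (h1 ▸ hvE')) hv0
  · intro p hp
    have hpE : p ∈ E := by rw [h1]; exact hp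
    exact (hmemE.1 hpE).2

/-- **"`dim P ≥ 2` is impossible": `dim M_{-n} = 1`** for an irreducible Lefschetz module over an algebraically
closed field in which only the type `V(n)` occurs, `n ≥ 2` — every line `K p₀ ⊆ M_{-n}` is stable in the sense of
§2 (every `e' ∈ 𝔞` being a multiple of `a` on `M_{-n}`), so `K p₀ = M_{-n}`.
[cite: LooijengaLunts1997, §1 (1.15) Proposition and proof, p. 8 L9–L11, L42–L46] -/
theorem IsLefschetzModule.finrank_degreeSpace_neg_depth_eq_one [IsAlgClosed K] (A : IsLefschetzModule K h 𝔞)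
    [Nontrivial M] [LieModule.IsIrreducible K (lefschetzLieAlgebra K h 𝔞) M] {f : Module.End K M} (ha : a ∈ 𝔞)
    (t : IsSl2Triple h a f) (hiso : ∀ j : ℕ, j ≠ depth h → primitiveSpace h a j = ⊥) (hn : 2 ≤ depth h) :
    finrank K ↥(degreeSpace h (-(depth h : ℤ))) = 1 := by
  have hgr := A.isZGrading
  have La := hasLefschetzProperty_of_isSl2Triple hgr t
  obtain ⟨p₀, hp₀, hp₀0⟩ := Submodule.exists_mem_ne_zero_of_ne_bot (La.degreeSpace_neg_depth_ne_bot hgr)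
  have hL : (K ∙ p₀) ≤ degreeSpace h (-(depth h : ℤ)) := (Submodule.span_singleton_le_iff_mem _ _).2 hp₀
  have hLe : ∀ e' ∈ 𝔞, ∀ l ∈ K ∙ p₀, e' l ∈ (K ∙ p₀).map a := by
    intro e' he' l hl
    obtain ⟨μ, hμ⟩ := A.exists_forall_apply_eq_smul ha t hiso hn he'
    rw [hμ _ (hL hl), ← map_smul]
    exact Submodule.mem_map_of_mem (Submodule.smul_mem _ μ hl)
  rcases A.eq_bot_or_eq_degreeSpace_of_stable ha t hL hLe with h1 | h1
  · exact absurd (Submodule.span_singleton_eq_bot.1 h1) hp₀0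
  · rw [← h1, finrank_span_singleton hp₀0]

end AlgClosed

/-! ### §4 "If `dim P = 1`": `𝔞 = K a`, `M ≅ V(n)`, `𝔤(𝔞, M) ≅ 𝔰𝔩(2)` -/

section DimOne

variable {K : Type*} [Field K] [CharZero K] {M : Type*} [AddCommGroup M] [Module K M] [FiniteDimensional K M]
  {h a : Module.End K M}

/-- **"If `dim P = 1`, then … the image of `𝔞` in `𝔤𝔩(M)` consists of multiples of `e`"**: if only `V(n)` occurs
and `dim M_{-n} = 1`, then every operator `e'` of degree `2` commuting with `a` is a multiple of `a` (they agree on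
the strings `a^i (c p₀)` spanning `M` as soon as `e' p₀ = μ a p₀`). [cite: LooijengaLunts1997, §1 (1.15) proof, p. 8 L41–L42] -/
theorem exists_eq_smul_of_finrank_eq_one (hgr : IsZGrading h) (La : HasLefschetzProperty h a)
    (hiso : ∀ j : ℕ, j ≠ depth h → primitiveSpace h a j = ⊥) (hd : 1 ≤ depth h)
    (h1 : finrank K ↥(degreeSpace h (-(depth h : ℤ))) = 1) {e' : Module.End K M}
    (he' : ∀ k : ℤ, MapsTo e' (degreeSpace h k) (degreeSpace h (k + 2))) (hc : Commute a e') :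
    ∃ μ : K, e' = μ • a := by
  obtain ⟨⟨p₀, hp₀⟩, hp₀0, hspan⟩ := finrank_eq_one_iff'.1 h1
  -- `e' p₀ ∈ M_{-n+2} = a (M_{-n}) = a (K p₀)`
  have h2 : e' p₀ ∈ degreeSpace h (-(depth h : ℤ) + 2 * (1 : ℕ)) := by
    have h3 := he' _ hp₀
    convert h3 using 2
    norm_num
  rw [degreeSpace_eq_map_pow_of_le La hiso (i := 1) hd, pow_one] at h2
  obtain ⟨q, hq, hq'⟩ := Submodule.mem_map.1 h2
  obtain ⟨μ, hμ⟩ := hspan ⟨q, hq⟩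
  have hμ' : q = μ • p₀ := by simpa using (congrArg Subtype.val hμ).symm
  refine ⟨μ, LinearMap.ext fun x ↦ ?_⟩
  have hx : x ∈ ⨆ i : Fin (depth h + 1), (degreeSpace h (-(depth h : ℤ))).map (a ^ (i : ℕ)) := by
    rw [iSup_map_pow_degreeSpace_neg_depth hgr La hiso]
    exact Submodule.mem_top
  refine Submodule.iSup_induction _ (motive := fun x ↦ e' x = (μ • a) x) hx ?_ ?_ ?_
  · intro i x hx
    obtain ⟨p, hp, rfl⟩ := Submodule.mem_map.1 hx
    obtain ⟨c, hc'⟩ := hspan ⟨p, hp⟩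
    have hcp : p = c • p₀ := by simpa using (congrArg Subtype.val hc').symm
    have hea : ∀ y, e' ((a ^ (i : ℕ)) y) = (a ^ (i : ℕ)) (e' y) := fun y ↦ by
      rw [← Module.End.mul_apply, ← (hc.pow_left _).eq, Module.End.mul_apply]
    have haa : ∀ y, a ((a ^ (i : ℕ)) y) = (a ^ (i : ℕ)) (a y) := fun y ↦ by
      rw [← Module.End.mul_apply, ← Module.End.mul_apply, ← pow_succ', ← pow_succ]
    rw [hcp]
    calc e' ((a ^ (i : ℕ)) (c • p₀)) = (a ^ (i : ℕ)) (e' (c • p₀)) := hea _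
      _ = (a ^ (i : ℕ)) (c • a (μ • p₀)) := by rw [map_smul, ← hq', hμ']
      _ = c • μ • (a ^ (i : ℕ)) (a p₀) := by rw [map_smul, map_smul, map_smul]
      _ = (μ • a) ((a ^ (i : ℕ)) (c • p₀)) := by
        rw [LinearMap.smul_apply, map_smul, map_smul, haa, smul_comm]
  · rw [map_zero, map_zero]
  · intro x y hx hy
    rw [map_add, map_add, hx, hy]

variable {𝔞 : Submodule K (Module.End K M)}

/-- **`𝔞 = K a`** ("the image of `𝔞` in `𝔤𝔩(M)` consists of multiples of `e`") for a Lefschetz module in which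
only `V(n)` occurs and `dim M_{-n} = 1`. [cite: LooijengaLunts1997, §1 (1.15) proof, p. 8 L41–L42] -/
theorem IsLefschetzModule.eq_span_singleton_of_finrank_eq_one (A : IsLefschetzModule K h 𝔞) {f : Module.End K M}
    (ha : a ∈ 𝔞) (t : IsSl2Triple h a f) (hiso : ∀ j : ℕ, j ≠ depth h → primitiveSpace h a j = ⊥)
    (h1 : finrank K ↥(degreeSpace h (-(depth h : ℤ))) = 1) : 𝔞 = K ∙ a := by
  have hgr := A.isZGrading
  have La := hasLefschetzProperty_of_isSl2Triple hgr t
  have hS : Nontrivial ↥(degreeSpace h (-(depth h : ℤ))) := Module.nontrivial_of_finrank_pos (R := K) (by omega)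
  obtain ⟨p₀, -, hp₀0⟩ := Submodule.exists_mem_ne_zero_of_ne_bot (Submodule.nontrivial_iff_ne_bot.1 hS)
  haveI : Nontrivial M := nontrivial_of_ne p₀ 0 hp₀0
  have hd : 1 ≤ depth h := depth_pos hgr La t.h_ne_zero
  refine le_antisymm (fun e' he' ↦ ?_) ((Submodule.span_singleton_le_iff_mem _ _).2 ha)
  obtain ⟨μ, rfl⟩ := exists_eq_smul_of_finrank_eq_one hgr La hiso hd h1 (A.mapsTo he') (A.commute ha he')
  exact Submodule.mem_span_singleton.2 ⟨μ, rfl⟩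

/-- **"`M ≅ V(n)`": `dim M = n + 1`** when only `V(n)` occurs and `dim M_{-n} = 1` — `M` is spanned by one string
`p₀, a p₀, …, a^n p₀` of non-zero vectors of distinct degrees. [cite: LooijengaLunts1997, §1 (1.15) proof, p. 8 L41–L42] -/
theorem finrank_eq_depth_add_one_of_finrank_eq_one (hgr : IsZGrading h) (La : HasLefschetzProperty h a)
    (hiso : ∀ j : ℕ, j ≠ depth h → primitiveSpace h a j = ⊥)
    (h1 : finrank K ↥(degreeSpace h (-(depth h : ℤ))) = 1) : finrank K M = depth h + 1 := by
  obtain ⟨⟨p₀, hp₀⟩, hp₀0, hspan⟩ := finrank_eq_one_iff'.1 h1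
  have hp₀0' : p₀ ≠ 0 := fun h0 ↦ hp₀0 (Subtype.ext h0)
  -- the string `v i = a^i p₀`, `0 ≤ i ≤ n`
  set v : Fin (depth h + 1) → M := fun i ↦ (a ^ (i : ℕ)) p₀ with hv_def
  refine le_antisymm ?_ ?_
  · -- `M` is spanned by the string
    have htop : (⊤ : Submodule K M) ≤ Submodule.span K (Set.range v) := by
      rw [← iSup_map_pow_degreeSpace_neg_depth hgr La hiso]
      refine iSup_le fun i ↦ ?_
      rw [Submodule.map_le_iff_le_comap]
      intro p hp
      obtain ⟨c, hc⟩ := hspan ⟨p, hp⟩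
      have hcp : p = c • p₀ := by simpa using (congrArg Subtype.val hc).symm
      rw [Submodule.mem_comap, hcp, map_smul]
      exact Submodule.smul_mem _ c (Submodule.subset_span ⟨i, rfl⟩)
    calc finrank K M = finrank K (⊤ : Submodule K M) := (finrank_top K M).symm
      _ ≤ finrank K (Submodule.span K (Set.range v)) := Submodule.finrank_mono htop
      _ ≤ Fintype.card (Fin (depth h + 1)) := finrank_range_le_card v
      _ = depth h + 1 := Fintype.card_fin _
  · -- the string is linearly independent: eigenvectors of `h` for the distinct eigenvalues `-n + 2i`
    have hv : LinearIndependent K v := by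
      refine Module.End.eigenvectors_linearIndependent' h
        (fun i : Fin (depth h + 1) ↦ ((-(depth h : ℤ) + 2 * ((i : ℕ) : ℤ) : ℤ) : K)) (fun i j hij ↦ ?_) v
        fun i ↦ ?_
      · have h2 := Int.cast_injective (α := K) hij
        exact Fin.ext (by omega)
      · rw [Module.End.hasEigenvector_iff]
        refine ⟨pow_apply_mem_degreeSpace La.mapsTo hp₀ i, fun h0 ↦ hp₀0' ?_⟩
        refine La.eq_zero_of_pow_apply_eq_zero (n := (depth h : ℤ)) (by omega) hp₀ ?_
        rw [Int.toNat_natCast]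
        have e1 : a ^ depth h = a ^ (depth h - i) * a ^ (i : ℕ) := by
          rw [← pow_add, Nat.sub_add_cancel (by omega)]
        rw [e1, Module.End.mul_apply]
        change (a ^ (depth h - i)) (v i) = 0
        rw [h0, map_zero]
    simpa using hv.fintype_card_le_finrank

/-- **"the image of `𝔤` in `𝔤𝔩(M)` is a copy of `𝔰𝔩(2)`": `𝔤(K a, M) = span {a, h, f}`** — for an
`𝔰𝔩₂`-triple `(a, h, f)` of `𝔤𝔩(M)` on a `ℤ`-graded `(M, h)`, the Lie subalgebra generated by `K a` and the
partners of its Lefschetz elements `c a`, `c ≠ 0` (namely `c⁻¹ f`, by the uniqueness of the partner) is the span of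
the triple, which is closed under brackets. [cite: LooijengaLunts1997, §1 (1.15) proof, p. 8 L41–L42] -/
theorem toSubmodule_lefschetzLieAlgebra_span_singleton (hgr : IsZGrading h) {f : Module.End K M}
    (t : IsSl2Triple h a f) :
    (lefschetzLieAlgebra K h (K ∙ a)).toSubmodule = Submodule.span K {a, h, f} := by
  have La := hasLefschetzProperty_of_isSl2Triple hgr t
  have ha' : a ∈ Submodule.span K ({a, h, f} : Set (Module.End K M)) := Submodule.subset_span (by simp)
  have hh' : h ∈ Submodule.span K ({a, h, f} : Set (Module.End K M)) := Submodule.subset_span (by simp)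
  have hf' : f ∈ Submodule.span K ({a, h, f} : Set (Module.End K M)) := Submodule.subset_span (by simp)
  -- brackets of the generators
  have hgen : ∀ x ∈ ({a, h, f} : Set (Module.End K M)), ∀ y ∈ ({a, h, f} : Set (Module.End K M)),
      ⁅x, y⁆ ∈ Submodule.span K ({a, h, f} : Set (Module.End K M)) := by
    intro x hx y hy
    simp only [Set.mem_insert_iff, Set.mem_singleton_iff] at hx hy
    rcases hx with rfl | rfl | rfl <;> rcases hy with rfl | rfl | rfl
    · rw [lie_self]; exact Submodule.zero_mem _
    · rw [← lie_skew, t.lie_h_e_nsmul]; exact Submodule.neg_mem _ (nsmul_mem ha' 2)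
    · rw [t.lie_e_f]; exact hh'
    · rw [t.lie_h_e_nsmul]; exact nsmul_mem ha' 2
    · rw [lie_self]; exact Submodule.zero_mem _
    · rw [t.lie_h_f_nsmul]; exact Submodule.neg_mem _ (nsmul_mem hf' 2)
    · rw [← lie_skew, t.lie_e_f]; exact Submodule.neg_mem _ hh'
    · rw [← lie_skew, t.lie_h_f_nsmul, neg_neg]; exact nsmul_mem hf' 2
    · rw [lie_self]; exact Submodule.zero_mem _
  -- so the span is closed under brackets
  have hbr : ∀ x ∈ Submodule.span K ({a, h, f} : Set (Module.End K M)),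
      ∀ y ∈ Submodule.span K ({a, h, f} : Set (Module.End K M)),
        ⁅x, y⁆ ∈ Submodule.span K ({a, h, f} : Set (Module.End K M)) := by
    intro x hx y hy
    refine Submodule.span_induction (p := fun x _ ↦ ⁅x, y⁆ ∈ Submodule.span K ({a, h, f} : Set (Module.End K M)))
      ?_ ?_ ?_ ?_ hx
    · intro x hx'
      refine Submodule.span_induction
        (p := fun y _ ↦ ⁅x, y⁆ ∈ Submodule.span K ({a, h, f} : Set (Module.End K M))) ?_ ?_ ?_ ?_ hy
      · exact fun y hy' ↦ hgen x hx' y hy'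
      · rw [lie_zero]; exact Submodule.zero_mem _
      · intro y z _ _ hy hz; rw [lie_add]; exact Submodule.add_mem _ hy hz
      · intro c y _ hy; rw [lie_smul]; exact Submodule.smul_mem _ c hy
    · rw [zero_lie]; exact Submodule.zero_mem _
    · intro x z _ _ hx hz; rw [add_lie]; exact Submodule.add_mem _ hx hz
    · intro c x _ hx; rw [smul_lie]; exact Submodule.smul_mem _ c hx
  let S : LieSubalgebra K (Module.End K M) :=
    { Submodule.span K ({a, h, f} : Set (Module.End K M)) with
      lie_mem' := fun {x y} hx hy ↦ hbr x hx y hy }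
  refine le_antisymm ?_ ?_
  · -- `𝔤(K a, M) ≤ S`: `K a ⊆ S`, and the partner of a Lefschetz `c a` is `c⁻¹ f`
    have hle : lefschetzLieAlgebra K h (K ∙ a) ≤ S := by
      rw [lefschetzLieAlgebra_le_iff]
      constructor
      · intro x hx
        obtain ⟨c, rfl⟩ := Submodule.mem_span_singleton.1 hx
        exact Submodule.smul_mem _ c ha'
      · rintro f' ⟨e, he, t'⟩
        obtain ⟨c, rfl⟩ := Submodule.mem_span_singleton.1 he
        have hc0 : c ≠ 0 := by
          rintro rfl
          exact t'.h_ne_zero (by rw [← t'.lie_e_f, zero_smul, zero_lie])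
        have t'' : IsSl2Triple h a (c • f') :=
          { h_ne_zero := t.h_ne_zero
            lie_e_f := by rw [lie_smul, ← smul_lie, t'.lie_e_f]
            lie_h_e_nsmul := t.lie_h_e_nsmul
            lie_h_f_nsmul := by rw [lie_smul, t'.lie_h_f_nsmul, smul_neg, smul_comm c (2 : ℕ) f'] }
        have h2 : c • f' = f := by
          rw [La.eq_dual_of_isSl2Triple hgr t'', ← La.eq_dual_of_isSl2Triple hgr t]
        have h3 : f' = c⁻¹ • f := by rw [← h2, smul_smul, inv_mul_cancel₀ hc0, one_smul]
        rw [h3]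
        exact Submodule.smul_mem _ _ hf'
    exact fun x hx ↦ hle hx
  · -- `span {a, h, f} ≤ 𝔤(K a, M)`
    have ha𝔤 : a ∈ lefschetzLieAlgebra K h (K ∙ a) :=
      mem_lefschetzLieAlgebra_of_mem (Submodule.mem_span_singleton_self a)
    have hf𝔤 : f ∈ lefschetzLieAlgebra K h (K ∙ a) :=
      mem_lefschetzLieAlgebra_of_isSl2Triple (Submodule.mem_span_singleton_self a) t
    have hh𝔤 : h ∈ lefschetzLieAlgebra K h (K ∙ a) :=
      h_mem_lefschetzLieAlgebra_of_isSl2Triple (Submodule.mem_span_singleton_self a) t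
    rw [Submodule.span_le]
    intro x hx
    simp only [Set.mem_insert_iff, Set.mem_singleton_iff] at hx
    rcases hx with rfl | rfl | rfl
    exacts [ha𝔤, hh𝔤, hf𝔤]

omit [FiniteDimensional K M] in
/-- … and **that copy of `𝔰𝔩(2)` has dimension `3`**: an `𝔰𝔩₂`-triple `(a, h, f)` of `𝔤𝔩(M)` is linearly
independent (`a`, `h`, `f` are non-zero eigenvectors of `ad h` for the distinct eigenvalues `2`, `0`, `-2`).
[cite: LooijengaLunts1997, §1 (1.15) p. 8 L9–L10 ("reduced to 𝔰𝔩(2)")] -/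
theorem finrank_span_sl2Triple {f : Module.End K M} (t : IsSl2Triple h a f) :
    finrank K ↥(Submodule.span K ({a, h, f} : Set (Module.End K M))) = 3 := by
  -- `ad h` as a linear endomorphism of `𝔤𝔩(M)`
  set D : Module.End K (Module.End K M) := LinearMap.mulLeft K h - LinearMap.mulRight K h with hD
  have hDapply : ∀ x, D x = ⁅h, x⁆ := fun x ↦ by
    rw [hD, LinearMap.sub_apply, LinearMap.mulLeft_apply, LinearMap.mulRight_apply, Ring.lie_def]
  have ha0 : a ≠ 0 := fun h0 ↦ t.h_ne_zero (by rw [← t.lie_e_f, h0, zero_lie])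
  have hf0 : f ≠ 0 := fun h0 ↦ t.h_ne_zero (by rw [← t.lie_e_f, h0, lie_zero])
  set v : Fin 3 → Module.End K M := ![a, h, f] with hv_def
  set μ : Fin 3 → K := ![2, 0, -2] with hμ_def
  have hv : LinearIndependent K v := by
    refine Module.End.eigenvectors_linearIndependent' D μ (fun i j hij ↦ ?_) v fun i ↦ ?_
    · fin_cases i <;> fin_cases j <;> first | rfl | norm_num [hμ_def] at hij
    · rw [Module.End.hasEigenvector_iff, Module.End.mem_eigenspace_iff, hDapply]
      fin_cases i
      · exact ⟨by simpa [hv_def, hμ_def, two_smul] using t.lie_h_e_nsmul, by simpa [hv_def] using ha0⟩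
      · exact ⟨by simp [hv_def, hμ_def], by simpa [hv_def] using t.h_ne_zero⟩
      · exact ⟨by simpa [hv_def, hμ_def, two_smul] using t.lie_h_f_nsmul, by simpa [hv_def] using hf0⟩
  have hrange : Set.range v = {a, h, f} := by
    rw [hv_def, Matrix.range_cons, Matrix.range_cons, Matrix.range_cons, Matrix.range_empty,
      Set.union_empty]
    ext x
    simp only [Set.mem_union, Set.mem_singleton_iff, Set.mem_insert_iff]
  rw [← hrange, finrank_span_eq_card hv, Fintype.card_fin]

end DimOne

/-! ### §5 (1.15), second sentence -/

section Main

variable {K : Type*} [Field K] [CharZero K] {M : Type*} [AddCommGroup M] [Module K M] [FiniteDimensional K M]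
  {h a : Module.End K M} {𝔞 : Submodule K (Module.End K M)}

/-- **"The irreducibility of `M` implies that the elements of `I` all have the same parity"**: in an irreducible
Lefschetz module `M ≠ 0` of depth `n`, `M_m = 0` unless `m ≡ n (mod 2)` (`M = M_ev ⊕ M_odd` is a decomposition into
`𝔤(𝔞, M)`-stable subspaces, A1-88 §10, and `M_{-n} ≠ 0`). [cite: LooijengaLunts1997, §1 (1.15) proof, p. 8 L17–L18]
[cite: LooijengaLunts1997, §1 (1.1) p. 4 L64–L66 ("M = M_ev ⊕ M_odd")] -/
theorem IsLefschetzModule.degreeSpace_eq_bot_of_ne (A : IsLefschetzModule K h 𝔞) [Nontrivial M]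
    [LieModule.IsIrreducible K (lefschetzLieAlgebra K h 𝔞) M] {m : ℤ}
    (hm : ∀ k : ℤ, m ≠ -(depth h : ℤ) + 2 * k) : degreeSpace h m = ⊥ := by
  have hgr := A.isZGrading
  obtain ⟨e, -, Le⟩ := A.exists_hasLefschetzProperty
  have hirr := (isIrreducible_iff_forall_stable (h := h) (𝔞 := 𝔞)).1 ‹_›
  have hev : evenPart h = ⊥ ∨ evenPart h = ⊤ :=
    hirr _ fun x hx v hv ↦ (A.mapsTo_evenPart_oddPart hx).1 hv
  have hod : oddPart h = ⊥ ∨ oddPart h = ⊤ :=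
    hirr _ fun x hx v hv ↦ (A.mapsTo_evenPart_oddPart hx).2 hv
  have hbot := Le.degreeSpace_neg_depth_ne_bot hgr
  have hdisj := disjoint_evenPart_oddPart (h := h)
  rcases Int.even_or_odd' (-(depth h : ℤ)) with ⟨q, hq | hq⟩
  · -- `n` even: `M_ev = M`, `M_odd = 0`, and `m` is odd
    have hev' : evenPart h = ⊤ := by
      refine hev.resolve_left fun h0 ↦ hbot ?_
      rw [eq_bot_iff, ← h0, hq]
      exact degreeSpace_le_evenPart q
    rw [hev'] at hdisj
    have hod' : oddPart h = ⊥ := top_disjoint.1 hdisj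
    rcases Int.even_or_odd' m with ⟨k, hk | hk⟩
    · exact absurd hk (by have := hm (k - q); omega)
    · rw [eq_bot_iff, ← hod', hk]
      exact degreeSpace_le_oddPart k
  · -- `n` odd: `M_odd = M`, `M_ev = 0`, and `m` is even
    have hod' : oddPart h = ⊤ := by
      refine hod.resolve_left fun h0 ↦ hbot ?_
      rw [eq_bot_iff, ← h0, hq]
      exact degreeSpace_le_oddPart q
    rw [hod'] at hdisj
    have hev' : evenPart h = ⊥ := disjoint_top.1 hdisj
    rcases Int.even_or_odd' m with ⟨k, hk | hk⟩
    · rw [eq_bot_iff, ← hev', hk]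
      exact degreeSpace_le_evenPart k
    · exact absurd hk (by have := hm (k - q); omega)

/-- **"`r = 0`" means "only `V(n)` occurs"**: if, in an irreducible Lefschetz module `M ≠ 0` of depth `n`, no type
`V(n - 2s)` with `1 ≤ s ≤ ⌊n/2⌋` occurs (`r = 0` in the notation of A1-113
`IsLefschetzModule.exists_primitiveSpace_ne_bot_iff`: `dim M_{-n} = dim M_{-n+2} = ⋯`), then `P_{-j} = 0` for
every `j ≠ n` (the types of the other parity by the previous lemma, `j > n` by the depth).
[cite: LooijengaLunts1997, §1 (1.15) Proposition, p. 8 L1–L11] -/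
theorem IsLefschetzModule.primitiveSpace_eq_bot_of_ne_depth (A : IsLefschetzModule K h 𝔞) [Nontrivial M]
    [LieModule.IsIrreducible K (lefschetzLieAlgebra K h 𝔞) M] {f : Module.End K M} (t : IsSl2Triple h a f)
    (hr : ∀ s : ℕ, 1 ≤ s → 2 * s ≤ depth h → primitiveSpace h a (depth h - 2 * s) = ⊥) {j : ℕ}
    (hj : j ≠ depth h) : primitiveSpace h a j = ⊥ := by
  have hgr := A.isZGrading
  have La := hasLefschetzProperty_of_isSl2Triple hgr t
  have hle : primitiveSpace h a j ≤ degreeSpace h (-(j : ℤ)) := fun x hx ↦ (mem_primitiveSpace_iff.1 hx).1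
  rcases lt_or_gt_of_ne hj with hlt | hgt
  · rcases Nat.even_or_odd' (depth h - j) with ⟨s, hs | hs⟩
    · have e1 : j = depth h - 2 * s := by omega
      rw [e1]
      exact hr s (by omega) (by omega)
    · rw [eq_bot_iff]
      refine hle.trans (le_of_eq (A.degreeSpace_eq_bot_of_ne (m := -(j : ℤ)) fun k hk ↦ ?_))
      omega
  · rw [eq_bot_iff]
    exact hle.trans (le_of_eq (La.degreeSpace_neg_eq_bot_of_depth_lt hgt))

/-- **(1.15) Proposition, second sentence: "Moreover, `r > 0` unless (i) the image of `𝔤` in `𝔤𝔩(M)` is reduced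
to `𝔰𝔩(2)` with `M ≅ V(n)` or (ii) the `𝔰𝔩(2)`-type of `M` consists of a number of copies of `V(1)`."**  For an
irreducible Lefschetz module `(𝔞, M)`, `M ≠ 0`, over an ALGEBRAICALLY CLOSED field of characteristic `0`, an
`𝔰𝔩₂`-triple `(a, h, f)` with `a ∈ 𝔞` and `r = 0` (no type `V(n - 2s)`, `1 ≤ s ≤ ⌊n/2⌋`, occurs): either the
depth is `1` (only `V(1)` occurs, (ii)), or `𝔞 = K a`, `dim M = n + 1` and `𝔤(𝔞, M) = span {a, h, f}` ((i)).
See the module docstring, SCOPE (a), for why algebraic closure is assumed. [cite: LooijengaLunts1997, §1 (1.15) Proposition and proof, p. 8 L9–L11, L36–L46] -/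
theorem IsLefschetzModule.depth_eq_one_or_eq_sl2_of_types_const [IsAlgClosed K] (A : IsLefschetzModule K h 𝔞)
    [Nontrivial M] [LieModule.IsIrreducible K (lefschetzLieAlgebra K h 𝔞) M] {f : Module.End K M} (ha : a ∈ 𝔞)
    (t : IsSl2Triple h a f)
    (hr : ∀ s : ℕ, 1 ≤ s → 2 * s ≤ depth h → primitiveSpace h a (depth h - 2 * s) = ⊥) :
    depth h = 1 ∨
      (𝔞 = K ∙ a ∧ finrank K M = depth h + 1 ∧
        (lefschetzLieAlgebra K h 𝔞).toSubmodule = Submodule.span K {a, h, f}) := by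
  have hgr := A.isZGrading
  have La := hasLefschetzProperty_of_isSl2Triple hgr t
  have hiso : ∀ j : ℕ, j ≠ depth h → primitiveSpace h a j = ⊥ :=
    fun j hj ↦ A.primitiveSpace_eq_bot_of_ne_depth t hr hj
  have hd : 1 ≤ depth h := depth_pos hgr La A.h_ne_zero
  rcases eq_or_lt_of_le hd with hd1 | hd2
  · exact Or.inl hd1.symm
  · right
    have h1 := A.finrank_degreeSpace_neg_depth_eq_one ha t hiso (by omega)
    have h𝔞 := A.eq_span_singleton_of_finrank_eq_one ha t hiso h1
    refine ⟨h𝔞, finrank_eq_depth_add_one_of_finrank_eq_one hgr La hiso h1, ?_⟩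
    rw [h𝔞]
    exact toSubmodule_lefschetzLieAlgebra_span_singleton hgr t

/-- The same dichotomy from the hypothesis "only `V(n)` occurs" (`P_{-j} = 0` for `j ≠ n`), without the detour
through `r`. [cite: LooijengaLunts1997, §1 (1.15) Proposition and proof, p. 8 L9–L11, L36–L46] -/
theorem IsLefschetzModule.depth_eq_one_or_eq_sl2_of_primitiveSpace_eq_bot [IsAlgClosed K]
    (A : IsLefschetzModule K h 𝔞) [Nontrivial M] [LieModule.IsIrreducible K (lefschetzLieAlgebra K h 𝔞) M]
    {f : Module.End K M} (ha : a ∈ 𝔞) (t : IsSl2Triple h a f)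
    (hiso : ∀ j : ℕ, j ≠ depth h → primitiveSpace h a j = ⊥) :
    depth h = 1 ∨
      (𝔞 = K ∙ a ∧ finrank K M = depth h + 1 ∧
        (lefschetzLieAlgebra K h 𝔞).toSubmodule = Submodule.span K {a, h, f}) :=
  A.depth_eq_one_or_eq_sl2_of_types_const ha t fun s _ _ ↦ hiso _ (by omega)

end Main

end Literature.Algebra.Lie
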